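import Mathlib

/-!
# Shape diversity of near-apex ladders — packing-certificate proof

Support file for item `stmt-MatrixMultiplication-14308` (`FourierTwoFamiliesModP.PrimeTwoFamilies`,
CKSU 2005 Conj. 4.7 with prime cyclic hosts), line `Sketch`, registered stub
`ladder_rpow_le_rightShapes` (siege k8, variation "certificate on the finite core"; an independent
proof of the statement landed in namespace `…Theorems.PrimeTwoFamilies.LadderLift`).

A LADDER in an abelian group `G` is a family of `r` classes `(X c, Y c)`, `c : Fin r`, with

* (`hW`) every class direct: `(x - x') + (y - y') = 0` with `x, x' ∈ X c`, `y, y' ∈ Y c` forces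
  `x = x'` and `y = y'`;
* (`hL`) for classes `p < q` every cross difference `y' - x'` (`x' ∈ X p`, `y' ∈ Y q`) avoids every
  diagonal difference `y - x` (`x ∈ X c`, `y ∈ Y c`, any class `c`).

THE STATEMENT.  If the `Y`-sides are translates `Y c = u c +ᵥ Y₀ (κ c)` of `K` templates and the
ladder lies in the slice `ε` of the cyclic ladder conjecture in `ZMod m` (`m^{1/2-ε} ≤ r` classes,
co-volumes `m^{1-ε} ≤ |X c|·|Y c|`), then `m^{1/2-2ε} ≤ K`.

THE PROOF is split into a FINITE CORE and real-exponent bookkeeping.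

* Finite core (inside `ladder_rpow_le_rightShapes`): `Σ_c |X c|·|Y c| ≤ K·m`, certified by ONE
  explicit map, the *packing certificate*
  `(c, x, y) ↦ (κ c, x + y - u c) : Σ_c X c × Y c → Fin K × ZMod m`,
  which is injective (`packingCertificate_injOn`): writing `y = u c + b` with `b` in the template, the
  second coordinate is `x + b`; a collision inside one class is a vanishing sum of differences,
  excluded by `hW`; a collision between classes `i < k` with the same template reads
  `(u k + b) - x' = (u k + b') - x`, a diagonal difference of class `k` equal to a cross difference
  from `X i × Y k`, excluded by `hL` (symmetrically for `k < i`).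
* Bookkeeping (`rpow_le_of_packing`): `m^{1/2-ε}·m^{1-ε} ≤ r·m^{1-ε} ≤ Σ_c |X c|·|Y c| ≤ K·m`, and
  `m^{1/2-ε}·m^{1-ε} = m^{1/2-2ε}·m`; cancel `m > 0`.
-/

-- single-conjunct summit: the mandated namespace repeats `MatrixMultiplication` (summit = sub-problem).
set_option linter.dupNamespace false

namespace Summit.MatrixMultiplication.MatrixMultiplication.Theorems.PrimeTwoFamilies.LadderLift.SiegeK8

open Finset
open scoped Pointwise

/-- **The packing certificate is injective.**  For a ladder `(X c, Y c)_{c<r}` whose `Y`-sides are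
translates `Y c = u c +ᵥ Y₀ (κ c)` of `K` templates, the map `(c, x, y) ↦ (κ c, x + y - u c)` is
injective on `Σ_c X c × Y c`. -/
theorem packingCertificate_injOn {G : Type*} [AddCommGroup G] [DecidableEq G] {r K : ℕ}
    (X Y : Fin r → Finset G)
    (hW : ∀ c : Fin r, ∀ x ∈ X c, ∀ x' ∈ X c, ∀ y ∈ Y c, ∀ y' ∈ Y c,
      (x - x') + (y - y') = 0 → x = x' ∧ y = y')
    (hL : ∀ c p q : Fin r, p < q → ∀ x ∈ X c, ∀ y ∈ Y c, ∀ x' ∈ X p, ∀ y' ∈ Y q, y - x ≠ y' - x')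
    (Y₀ : Fin K → Finset G) (κ : Fin r → Fin K) (u : Fin r → G)
    (hY : ∀ c, Y c = u c +ᵥ Y₀ (κ c)) :
    Set.InjOn (fun z : (Σ _ : Fin r, G × G) => (κ z.1, z.2.1 + z.2.2 - u z.1))
      ↑((Finset.univ : Finset (Fin r)).sigma fun c => X c ×ˢ Y c) := by
  -- every template point, shifted by `u c`, lies in `Y c`
  have memY : ∀ c : Fin r, ∀ b ∈ Y₀ (κ c), u c + b ∈ Y c := fun c b hb => by
    rw [hY c]
    exact Finset.mem_vadd_finset.2 ⟨b, hb, rfl⟩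
  rintro ⟨i, a, y⟩ hx ⟨k, a', y'⟩ hx' h
  simp only [Finset.mem_coe, Finset.mem_sigma, Finset.mem_univ, true_and, Finset.mem_product] at hx hx'
  obtain ⟨ha, hy⟩ := hx
  obtain ⟨ha', hy'⟩ := hx'
  simp only [Prod.mk.injEq] at h
  obtain ⟨hκ, hsum⟩ := h
  -- read the `Y`-coordinates through the templates: `y = u i + b`, `y' = u k + b'`
  rw [hY i] at hy
  rw [hY k] at hy'
  obtain ⟨b, hb, rfl⟩ := Finset.mem_vadd_finset.1 hy
  obtain ⟨b', hb', rfl⟩ := Finset.mem_vadd_finset.1 hy'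
  simp only [vadd_eq_add] at hsum ⊢
  -- `hsum : a + (u i + b) - u i = a' + (u k + b') - u k`, i.e. `a + b = a' + b'`
  rcases lt_trichotomy i k with hik | rfl | hik
  · -- `i < k`: diagonal pair `(a', u k + b)` of class `k` against the cross pair `(a, u k + b')`
    have hbk : b ∈ Y₀ (κ k) := hκ ▸ hb
    have e : (u k + b) - a' - ((u k + b') - a) = (a + (u i + b) - u i) - (a' + (u k + b') - u k) := by
      abel
    exact (hL k i k hik a' ha' (u k + b) (memY k b hbk) a ha (u k + b') (memY k b' hb')
      (sub_eq_zero.1 (by rw [e, hsum, sub_self]))).elim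
  · -- `i = k`: directness of the class
    have e : a - a' + (u i + b - (u i + b')) = (a + (u i + b) - u i) - (a' + (u i + b') - u i) := by
      abel
    obtain ⟨h1, h2⟩ := hW i a ha a' ha' (u i + b) (memY i b hb) (u i + b') (memY i b' hb')
      (by rw [e, hsum, sub_self])
    subst h1
    rw [add_left_cancel h2]
  · -- `k < i`: diagonal pair `(a, u i + b')` of class `i` against the cross pair `(a', u i + b)`
    have hbi : b' ∈ Y₀ (κ i) := hκ ▸ hb'
    have e : (u i + b') - a - ((u i + b) - a') = -((a + (u i + b) - u i) - (a' + (u k + b') - u k)) := by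
      abel
    exact (hL i k i hik a ha (u i + b') (memY i b' hbi) a' ha' (u i + b) (memY i b hb)
      (sub_eq_zero.1 (by rw [e, hsum, sub_self, neg_zero]))).elim

/-- **Exponent bookkeeping.**  If `m^{1/2-ε} ≤ r`, every `P c ≥ m^{1-ε}` (`c : Fin r`) and
`Σ_c P c ≤ K·m` with `0 < m`, then `m^{1/2-2ε} ≤ K`:
`m^{1/2-2ε}·m = m^{1/2-ε}·m^{1-ε} ≤ r·m^{1-ε} ≤ Σ_c P c ≤ K·m`. -/
theorem rpow_le_of_packing {m r K : ℕ} (hm : 0 < m) (P : Fin r → ℕ) {ε : ℝ}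
    (hr : (m : ℝ) ^ (1 / 2 - ε) ≤ (r : ℝ)) (hP : ∀ c : Fin r, (m : ℝ) ^ (1 - ε) ≤ (P c : ℝ))
    (hsum : ∑ c, P c ≤ K * m) : (m : ℝ) ^ (1 / 2 - 2 * ε) ≤ (K : ℝ) := by
  have hmpos : (0 : ℝ) < m := by exact_mod_cast hm
  have hsum' : ∑ c, (P c : ℝ) ≤ (K : ℝ) * (m : ℝ) := by exact_mod_cast hsum
  have h1 : (r : ℝ) * (m : ℝ) ^ (1 - ε) ≤ (K : ℝ) * (m : ℝ) :=
    calc (r : ℝ) * (m : ℝ) ^ (1 - ε) = ∑ _c : Fin r, (m : ℝ) ^ (1 - ε) := by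
          rw [Finset.sum_const, Finset.card_univ, Fintype.card_fin, nsmul_eq_mul]
      _ ≤ ∑ c, (P c : ℝ) := Finset.sum_le_sum fun c _ => hP c
      _ ≤ (K : ℝ) * (m : ℝ) := hsum'
  have h2 : (m : ℝ) ^ (1 / 2 - 2 * ε) * (m : ℝ) ≤ (K : ℝ) * (m : ℝ) :=
    calc (m : ℝ) ^ (1 / 2 - 2 * ε) * (m : ℝ) = (m : ℝ) ^ (1 / 2 - ε) * (m : ℝ) ^ (1 - ε) := by
          rw [← Real.rpow_add_one hmpos.ne', ← Real.rpow_add hmpos]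
          congr 1
          ring
      _ ≤ (r : ℝ) * (m : ℝ) ^ (1 - ε) := mul_le_mul_of_nonneg_right hr (Real.rpow_nonneg hmpos.le _)
      _ ≤ (K : ℝ) * (m : ℝ) := h1
  exact le_of_mul_le_mul_right h2 hmpos

/-- **Shape diversity, right side** — registered stub `ladder_rpow_le_rightShapes` of crux
`stmt-MatrixMultiplication-14308`.  A ladder level of the cyclic ladder conjecture's slice `ε` in
`ZMod m` — `m^{1/2-ε} ≤ r` classes, co-volumes `m^{1-ε} ≤ |X c|·|Y c|` — whose `Y`-sides are
translates of at most `K` templates has `m^{1/2-2ε} ≤ K`.  FINITE CORE: the packing certificate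
embeds `Σ_c X c × Y c` into `Fin K × ZMod m` (`packingCertificate_injOn`), so
`Σ_c |X c|·|Y c| ≤ K·m`; then the exponent bookkeeping `rpow_le_of_packing`. -/
theorem ladder_rpow_le_rightShapes {m : ℕ} [NeZero m] {r K : ℕ} (X Y : Fin r → Finset (ZMod m))
    (hW : ∀ c : Fin r, ∀ x ∈ X c, ∀ x' ∈ X c, ∀ y ∈ Y c, ∀ y' ∈ Y c,
      (x - x') + (y - y') = 0 → x = x' ∧ y = y')
    (hL : ∀ c p q : Fin r, p < q → ∀ x ∈ X c, ∀ y ∈ Y c, ∀ x' ∈ X p, ∀ y' ∈ Y q, y - x ≠ y' - x')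
    (Y₀ : Fin K → Finset (ZMod m)) (κ : Fin r → Fin K) (u : Fin r → ZMod m)
    (hY : ∀ c, Y c = u c +ᵥ Y₀ (κ c))
    {ε : ℝ} (hr : (m : ℝ) ^ (1 / 2 - ε) ≤ (r : ℝ))
    (hP : ∀ c : Fin r, (m : ℝ) ^ (1 - ε) ≤ (((X c).card * (Y c).card : ℕ) : ℝ)) :
    (m : ℝ) ^ (1 / 2 - 2 * ε) ≤ (K : ℝ) := by
  -- finite core: `Σ_c |X c|·|Y c| = #(Σ_c X c × Y c) ≤ #(Fin K × ZMod m) = K·m`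
  have hcore : ∑ c, (X c).card * (Y c).card ≤ K * m :=
    calc ∑ c, (X c).card * (Y c).card
        = ∑ c, (X c ×ˢ Y c).card := Finset.sum_congr rfl fun c _ => (Finset.card_product _ _).symm
      _ = ((Finset.univ : Finset (Fin r)).sigma fun c => X c ×ˢ Y c).card :=
          (Finset.card_sigma _ _).symm
      _ ≤ (Finset.univ : Finset (Fin K × ZMod m)).card :=
          Finset.card_le_card_of_injOn
            (fun z : (Σ _ : Fin r, ZMod m × ZMod m) => (κ z.1, z.2.1 + z.2.2 - u z.1))
            (fun _ _ => Finset.mem_univ _) (packingCertificate_injOn X Y hW hL Y₀ κ u hY)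
      _ = K * m := by rw [Finset.card_univ, Fintype.card_prod, Fintype.card_fin, ZMod.card]
  exact rpow_le_of_packing (Nat.pos_of_ne_zero (NeZero.ne m)) (fun c => (X c).card * (Y c).card)
    hr hP hcore

end Summit.MatrixMultiplication.MatrixMultiplication.Theorems.PrimeTwoFamilies.LadderLift.SiegeK8
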